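import Summits.AtomisticToContinuum.Crystallization.Theorems.ChessboardParticlePlanesPeriodicWindowsGoodLimitB

/-!
# Crux `PeriodicWindows` (stmt-AtomisticToContinuum-3240), line `Sketch` — stub `stub_goodLimit`, C

The neighbour clauses of the compactness step E0a (`stub_goodLimit`) of the lead skeleton
`PeriodicWindowsSketch`, in the setting of part B (windows `y k`, radii `R k → ∞`, tolerances
`η k → 0`, normals `nrm k → nlim`, rotation `B` with `(B z) 2 = ⟪z, nlim⟫`, `19/20`-separated
local matching limit `X`). ONE statement `gl_nbr_clause` covers the three clauses "six same-height
points at distance `a`", "three points at a common height `p 2 + g` at distance `b`", "three points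
at a common height `p 2 - g` at distance `b`" through a sign `σ ∈ {0, 1, -1}`: if every half-window
particle `J` of every window has an injective family of `K` window neighbours (distance `≤ 1`)
with bonds `η k`-close to `L k` and offsets along `nrm k` that are `2 η k`-close to `σ G` for one
`G ≥ 19/25`, and `L k → Llim`, then every `p ∈ X` has `K` points of `X` at distance exactly `Llim`
and at one common height `p 2 + σ g`, `g > 0`.

Proof: `X ∩ B̄(p, 2)` is finite, so a tolerance `ε > 0` exists below which near-equalities of the
finitely many distances `dist p t` to `Llim`, heights `t 2` to `p 2`, and heights among themselves
are equalities; at one late window the approximant `J` of `p` and its `K` neighbours are matched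
back into `X ∩ B̄(p, 2)` within `ε` (second matching clause); the matched points are pairwise
distinct (window separation `19/20 > 2ε`), at distance `Llim` from `p` and of equal heights
`p 2 + σ G ± 5ε`, whence the clause with `g = σ · (height - p 2)` (`σ = ±1`) or `g = 1` (`σ = 0`).
-/

noncomputable section

namespace Summit.AtomisticToContinuum.Crystallization.Theorems.PeriodicWindowsSketch

open Literature.MathematicalPhysics.StatisticalMechanics Filter Metric Topology

/-- A robust tolerance at `p`: an `ε ∈ (0, 1/10]` such that, among the finitely many points of the
`19/20`-separated `X` in `B̄(p, 2)`, distances to `p` that are `10ε`-close to `Llim` equal `Llim`,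
heights `10ε`-close to `p 2` equal `p 2`, and heights `10ε`-close to each other are equal. -/
theorem gl_exists_robust_tolerance {X : Set (EuclideanSpace ℝ (Fin 3))}
    (hsepX : ∀ p ∈ X, ∀ q ∈ X, p ≠ q → (19 : ℝ) / 20 ≤ dist p q) (p : EuclideanSpace ℝ (Fin 3))
    (Llim : ℝ) :
    ∃ ε : ℝ, 0 < ε ∧ ε ≤ 1 / 10 ∧
      (∀ t ∈ X ∩ closedBall p 2, |dist p t - Llim| ≤ 10 * ε → dist p t = Llim) ∧
      (∀ t ∈ X ∩ closedBall p 2, |t 2 - p 2| ≤ 10 * ε → t 2 = p 2) ∧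
      (∀ t ∈ X ∩ closedBall p 2, ∀ t' ∈ X ∩ closedBall p 2,
        |t 2 - t' 2| ≤ 10 * ε → t 2 = t' 2) := by
  have hT : (X ∩ closedBall p 2).Finite :=
    finite_of_forall_le_dist_of_subset_closedBall (by norm_num : (0 : ℝ) < 19 / 20)
      (fun p hp q hq hpq => hsepX p hp.1 q hq.1 hpq) Set.inter_subset_right
  have hpos : ∀ᶠ ε in 𝓝[>] (0 : ℝ), ε ∈ Set.Ioi (0 : ℝ) := eventually_mem_nhdsWithin
  have hsmall : ∀ᶠ ε in 𝓝[>] (0 : ℝ), ε ≤ 1 / 10 :=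
    (eventually_le_nhds (by norm_num : (0 : ℝ) < 1 / 10)).filter_mono nhdsWithin_le_nhds
  obtain ⟨ε, h0, h1, h2, h3, h4⟩ := (hpos.and (hsmall.and
    ((gl_eventually_forall_eq_of_abs_sub_le hT (fun t => dist p t) Llim).and
    ((gl_eventually_forall_eq_of_abs_sub_le hT (fun t : EuclideanSpace ℝ (Fin 3) => t 2) (p 2)).and
    (gl_eventually_forall₂_eq_of_abs_sub_le hT (fun t : EuclideanSpace ℝ (Fin 3) => t 2)))))).exists
  exact ⟨ε, Set.mem_Ioi.1 h0, h1, h2, h3, h4⟩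

/-- **Neighbour clause (unified).** See the module docstring: `K` window neighbours with bonds
`η k`-close to `L k → Llim` and offsets along `nrm k` `2 η k`-close to `σ G` (`G ≥ 19/25`,
`σ ∈ {0, 1, -1}`) about every half-window particle give, at every `p ∈ X`, `K` points of `X` at
distance `Llim` and at a common height `p 2 + σ g` with `g > 0`. -/
theorem gl_nbr_clause {nn : ℕ → ℕ} {y : (k : ℕ) → Fin (nn k) → EuclideanSpace ℝ (Fin 3)}
    {i₀ : (k : ℕ) → Fin (nn k)}
    {R η : ℕ → ℝ} (hR : Tendsto R atTop atTop) (hη : Tendsto η atTop (𝓝 0))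
    {nrm : ℕ → EuclideanSpace ℝ (Fin 3)} {nlim : EuclideanSpace ℝ (Fin 3)}
    (hnrm : Tendsto nrm atTop (𝓝 nlim))
    {B : EuclideanSpace ℝ (Fin 3) ≃ₗᵢ[ℝ] EuclideanSpace ℝ (Fin 3)}
    (hB : ∀ z : EuclideanSpace ℝ (Fin 3), (B z) 2 = inner ℝ z nlim)
    {X : Set (EuclideanSpace ℝ (Fin 3))}
    (hsepX : ∀ p ∈ X, ∀ q ∈ X, p ≠ q → (19 : ℝ) / 20 ≤ dist p q)
    (hmatch : ∀ r ε : ℝ, 0 < ε → ∀ᶠ k in atTop, BallMatch ε r 0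
      {p | ∃ j : Fin (nn k), dist (y k j) (y k (i₀ k)) ≤ R k ∧ p = B (y k j - y k (i₀ k))} X)
    (hsepW : ∀ (k : ℕ) (j j' : Fin (nn k)), dist (y k j) (y k (i₀ k)) ≤ R k →
      dist (y k j') (y k (i₀ k)) ≤ R k → j ≠ j' → 19 / 20 ≤ dist (y k j) (y k j'))
    (K : ℕ) {σ : ℝ} (hσ : σ = 0 ∨ σ = 1 ∨ σ = -1) {L : ℕ → ℝ} {Llim : ℝ}
    (hL : Tendsto L atTop (𝓝 Llim))
    (hnbrW : ∀ (k : ℕ) (J : Fin (nn k)), dist (y k J) (y k (i₀ k)) ≤ R k / 2 →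
      ∃ g : Fin K → Fin (nn k), Function.Injective g ∧ ∃ G : ℝ, 19 / 25 ≤ G ∧ ∀ i, g i ≠ J ∧
        dist (y k (g i)) (y k (i₀ k)) ≤ R k ∧ dist (y k J) (y k (g i)) ≤ 1 ∧
        |dist (y k J) (y k (g i)) - L k| ≤ η k ∧
        |inner ℝ (y k (g i) - y k J) (nrm k) - σ * G| ≤ 2 * η k) :
    ∀ p ∈ X, ∃ g : ℝ, 0 < g ∧ ∃ F : Finset (EuclideanSpace ℝ (Fin 3)), F.card = K ∧
      ∀ q ∈ F, q ∈ X ∧ q 2 = p 2 + σ * g ∧ dist p q = Llim := by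
  intro p hp
  obtain ⟨ε, hε0, hε1, hrobL, hrob0, hrob2⟩ := gl_exists_robust_tolerance hsepX p Llim
  -- one late window
  obtain ⟨k, ⟨⟨⟨⟨⟨J, hJ, hJp⟩, hηk⟩, hnk⟩, hLk⟩, hBM⟩, -⟩ :=
    ((((((gl_eventually_approx hR hmatch hp hε0).and (hη.eventually (eventually_lt_nhds hε0))).and
      ((gl_tendsto_norm_sub_mul hnrm 1).eventually (eventually_lt_nhds hε0))).and
      (Metric.tendsto_nhds.1 hL ε hε0)).and (hmatch (‖p‖ + 3) ε hε0)).and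
      (hR.eventually_ge_atTop 0)).exists
  obtain ⟨g, hg, G, hG, hP⟩ := hnbrW k J hJ
  -- match the `K` neighbour images back into `X`
  have hmatchi : ∀ i : Fin K, ∃ t ∈ X, dist (B (y k (g i) - y k (i₀ k))) t ≤ ε := by
    intro i
    obtain ⟨-, hiR, hd, -, -⟩ := hP i
    refine hBM.2 _ ⟨g i, hiR, rfl⟩ ?_
    calc dist (B (y k (g i) - y k (i₀ k))) 0
        ≤ dist (B (y k (g i) - y k (i₀ k))) (B (y k J - y k (i₀ k))) +
            dist (B (y k J - y k (i₀ k))) p + dist p 0 := dist_triangle4 _ _ _ _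
      _ ≤ 1 + ε + ‖p‖ := by
          rw [gl_dist_map_sub_sub, dist_comm, dist_zero_right]
          exact add_le_add (add_le_add hd hJp) le_rfl
      _ ≤ ‖p‖ + 3 := by linarith
  choose t htX ht using hmatchi
  have hLk' := abs_lt.1 (show |L k - Llim| < ε by rwa [← Real.dist_eq])
  -- properties of the matched points
  have hprops : ∀ i, t i ∈ X ∩ closedBall p 2 ∧ dist p (t i) = Llim ∧
      |(t i) 2 - p 2 - σ * G| ≤ 5 * ε := by
    intro i
    obtain ⟨-, -, hd, hdL, hin⟩ := hP i
    have hdpi : dist (B (y k J - y k (i₀ k))) (B (y k (g i) - y k (i₀ k))) =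
        dist (y k J) (y k (g i)) := gl_dist_map_sub_sub B _ _ _
    have hdist : |dist p (t i) - dist (y k J) (y k (g i))| ≤ 2 * ε := by
      rw [← hdpi]
      have h1 := abs_dist_sub_le p (B (y k J - y k (i₀ k))) (t i)
      have h2 := abs_dist_sub_le (t i) (B (y k (g i) - y k (i₀ k))) (B (y k J - y k (i₀ k)))
      rw [dist_comm p (B (y k J - y k (i₀ k)))] at h1
      rw [dist_comm (t i) (B (y k J - y k (i₀ k))),
        dist_comm (B (y k (g i) - y k (i₀ k))) (B (y k J - y k (i₀ k))),
        dist_comm (t i) (B (y k (g i) - y k (i₀ k)))] at h2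
      have h1' := abs_le.1 (h1.trans hJp)
      have h2' := abs_le.1 (h2.trans (ht i))
      rw [abs_le]
      constructor <;> linarith
    have hdist' := abs_le.1 hdist
    have hTi : t i ∈ X ∩ closedBall p 2 := by
      refine ⟨htX i, mem_closedBall.2 ?_⟩
      rw [dist_comm]
      linarith
    have hdL' : dist p (t i) = Llim := by
      refine hrobL (t i) hTi ?_
      have := abs_le.1 hdL
      rw [abs_le]
      constructor <;> linarith
    -- heights
    have hdiff : y k (g i) - y k (i₀ k) - (y k J - y k (i₀ k)) = y k (g i) - y k J := by abel
    have hh :=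
      gl_abs_height_sub_sub_inner_le hB (nrm k) (y k (g i) - y k (i₀ k)) (y k J - y k (i₀ k))
    rw [hdiff] at hh
    have herr : ‖y k (g i) - y k J‖ * ‖nlim - nrm k‖ ≤ ε :=
      calc ‖y k (g i) - y k J‖ * ‖nlim - nrm k‖ ≤ 1 * ‖nlim - nrm k‖ := by
            refine mul_le_mul_of_nonneg_right ?_ (norm_nonneg _)
            rw [← dist_eq_norm, dist_comm]
            exact hd
        _ = ‖nrm k - nlim‖ * 1 := by rw [norm_sub_rev, mul_comm]
        _ ≤ ε := hnk.le
    have h1 := abs_le.1 ((gl_coord_sub_le_dist (B (y k J - y k (i₀ k))) p 2).trans hJp)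
    have h2 := abs_le.1 ((gl_coord_sub_le_dist (B (y k (g i) - y k (i₀ k))) (t i) 2).trans (ht i))
    have h3 := abs_le.1 (hh.trans herr)
    have h4 := abs_le.1 hin
    refine ⟨hTi, hdL', ?_⟩
    rw [abs_le]
    constructor <;> linarith
  -- the matched points are pairwise distinct
  have htinj : Function.Injective t := by
    intro i i' hii'
    by_contra hne
    have hgne : g i ≠ g i' := fun h => hne (hg h)
    obtain ⟨-, hiR, -, -, -⟩ := hP i
    obtain ⟨-, hi'R, -, -, -⟩ := hP i'
    have hsep := hsepW k (g i) (g i') hiR hi'R hgne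
    have : dist (y k (g i)) (y k (g i')) ≤ 2 * ε := by
      rw [← gl_dist_map_sub_sub B _ _ (y k (i₀ k))]
      calc dist (B (y k (g i) - y k (i₀ k))) (B (y k (g i') - y k (i₀ k)))
          ≤ dist (B (y k (g i) - y k (i₀ k))) (t i) + dist (t i) (B (y k (g i') - y k (i₀ k))) :=
            dist_triangle _ _ _
        _ ≤ ε + ε := add_le_add (ht i) (by rw [hii', dist_comm]; exact ht i')
        _ = 2 * ε := by ring
    linarith
  -- the matched points have one common height
  have hcommon : ∀ i i', (t i) 2 = (t i') 2 := by
    intro i i'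
    refine hrob2 (t i) (hprops i).1 (t i') (hprops i').1 ?_
    have := abs_le.1 (hprops i).2.2
    have := abs_le.1 (hprops i').2.2
    rw [abs_le]
    constructor <;> linarith
  rcases isEmpty_or_nonempty (Fin K) with hK | ⟨⟨i₁⟩⟩
  · have hK0 : K = 0 := by
      have := Fintype.card_eq_zero_iff.2 hK
      rwa [Fintype.card_fin] at this
    subst hK0
    exact ⟨1, one_pos, ∅, Finset.card_empty, fun q hq => absurd hq (Finset.notMem_empty q)⟩
  · have hh5 := abs_le.1 (hprops i₁).2.2
    obtain ⟨gg, hgg0, hggeq⟩ : ∃ gg : ℝ, 0 < gg ∧ (t i₁) 2 = p 2 + σ * gg := by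
      rcases hσ with hσ0 | hσ1 | hσm
      · subst hσ0
        refine ⟨1, one_pos, ?_⟩
        rw [zero_mul, add_zero]
        refine hrob0 (t i₁) (hprops i₁).1 ?_
        rw [zero_mul] at hh5
        rw [abs_le]
        constructor <;> linarith
      · subst hσ1
        refine ⟨(t i₁) 2 - p 2, ?_, by ring⟩
        rw [one_mul] at hh5
        linarith
      · subst hσm
        refine ⟨-((t i₁) 2 - p 2), ?_, by ring⟩
        linarith
    refine ⟨gg, hgg0, Finset.univ.image t, ?_, ?_⟩
    · rw [Finset.card_image_of_injective _ htinj, Finset.card_univ, Fintype.card_fin]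
    · intro q hq
      obtain ⟨i, -, rfl⟩ := Finset.mem_image.1 hq
      exact ⟨htX i, (hcommon i i₁).trans hggeq, (hprops i).2.1⟩

end Summit.AtomisticToContinuum.Crystallization.Theorems.PeriodicWindowsSketch

end
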